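import Summits.ResolutionOfSingularities.ResolutionOfSingularities.Theorems.PurelyInseparableDim4ResConeResidualTransform
import Summits.ResolutionOfSingularities.ResolutionOfSingularities.Theorems.PurelyInseparableDim4ResConeExceptionalRestriction
import HarnessLib
import HarnessLib.Audit.Tags

/-!
# Purely inseparable four-folds — LEDGER PERSISTENCE: `u·G ∈ (x_a, h^d)` survives every `E_a`-keeping band
# step as `T₀u · G′ ∈ (x_a, (T₁h)^d)` (K2(p) lane, slice B, memo (K4); cell `res-dim4-pi`)

[OURS · counted 0 · cell `res-dim4-pi` · K2(p) lane holder res-dim4-p-12 g3's SLICE-B KERNEL ARCHITECTURE MEMO v1.1,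
brick (K4) by the holder's signature (2026-08-28 23:28Z), seat res-dim4-p-3 g3.]  Nothing here proves K2(p),
`NoIsolatedTrap p p` or resolution of singularities in dimension ≥ 4 / characteristic `p`.  AI kernel work, weaker
than expert review.

Setting (`…ResConeResidualTransform` = K5(a), `…ResConeExceptionalRestriction` = K3): state `s = (F, r, exc)`,
`x^r ∣ F`, `ord₀ F = o > q`, residual `G = F / x^r`, `d = o − |r|`; point step at `b` in the `x_j`-chart (`b_j = 0`),
`s′ = CentreBlowup.step q univ j b s`, `G′ = s′.F / x^{r′}`; `T_m := chartTransform m univ j ∘ shear j b`.  A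
boundary letter `a ≠ j` with `b_a = 0` is KEPT by the step (`r′_a = r_a`).
* §1 `chartTransform_one_shear_X_of_ne` (`T₁ x_a = x_a`), `constantCoeff_chartTransform_zero`,
  `eval_chartTransform_zero_shear` (`(T₀u)(0) = u(0)`: units stay units), degree bookkeeping.
* §2 **`ledger_persist`** — if `1 ≤ r_a < q` and `u·G ∈ (x_a, h^d)` with `h ∈ 𝔪₀`, then
  `T₀u · G′ ∈ (x_a, (T₁h)^d)`; NO shade hypothesis.  Proof: `u G = S x_a + T h^d` forces `ord S ≥ d − 1`, so
  `x_j^d · T_d(uG) = σ_j(shear(uG)) = x_j^d (x_a · T_{d−1}S + T₀T · (T₁h)^d)`; `T₀u · T_dG = T_d(uG)` (K5(a)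
  `chartTransform_mul`); `G′ = (lost units) · T_dG − (deleted part)` (K5(a) `divMonomial_step_F_add_deleted`) and every
  deleted monomial `x^{E − r′}` has `q ∣ E_a ≥ r_a ≥ 1`, hence `E_a − r_a ≥ q − r_a ≥ 1`: it lies in `(x_a)`.
* §3 `constantCoeff_chartTransform_one`, `coeff_shear_eq_coeff_shear_homogeneousComponent`,
  `coeff_single_shear_linearForm`, **`ledger_persist_mem_originIdeal`** — the transported contact polynomial
  `T₁h` still vanishes at the child when `lin h = c·ℓ + c′·x_a` (p-11's K9) and `ℓ_j + ℓ·b = 0` ((VT)(i)).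
bears_on: LADDER-RESOLUTION:D157-DOOR2 (res-dim4-pi · K2(p) · slice B (K4)).  Supports
stmt-ResolutionOfSingularities-16155 (helper).
-/

set_option linter.dupNamespace false -- mandated namespace of this single-conjunct summit

noncomputable section

namespace Summit.ResolutionOfSingularities.ResolutionOfSingularities.Theorems.PIDim4

namespace ResCone

open MvPolynomial Finset
open Literature.AlgebraicGeometry.Resolution
open Literature.AlgebraicGeometry.Resolution.CentreBlowup
open Literature.AlgebraicGeometry.Resolution.Hauser2010
open Literature.AlgebraicGeometry.Resolution.HauserPerlega2019

variable {K : Type} [Field K]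

/-! ## 1. Small transforms and degree bookkeeping -/

/-- A kept boundary letter is fixed: `T₁(x_a) = chartTransform 1 (shear j b x_a) = x_a` for `a ≠ j`, `b_a = 0`.
[folklore] -/
theorem chartTransform_one_shear_X_of_ne {j a : Fin 4} (hja : j ≠ a) {b : Fin 4 → K} (hba : b a = 0) :
    chartTransform 1 Finset.univ j (shear j b (X a : MvPolynomial (Fin 4) K)) = X a := by
  rw [shear_X_of_ne hja.symm, hba, C_0, zero_mul, add_zero]
  unfold chartTransform
  rw [support_X, Finset.sum_singleton]
  have hE : chartExponent 1 Finset.univ j (Finsupp.single a 1) = Finsupp.single a 1 := by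
    ext i
    by_cases hij : i = j
    · rw [hij, chartExponent_univ_apply_self, Finsupp.degree_single, Finsupp.single_eq_of_ne hja, Nat.sub_self]
    · rw [chartExponent_apply_of_ne 1 Finset.univ hij]
  rw [coeff_X_same, hE]
  rfl

/-- The constant term of `chartTransform 0 univ j P` is the constant term of `P`. [folklore] -/
theorem constantCoeff_chartTransform_zero (j : Fin 4) (P : MvPolynomial (Fin 4) K) :
    constantCoeff (chartTransform 0 Finset.univ j P) = constantCoeff P := by
  classical
  unfold chartTransform
  rw [map_sum]
  simp_rw [constantCoeff_monomial]
  have hiff : ∀ d ∈ P.support, (chartExponent 0 Finset.univ j d = 0 ↔ (0 : Fin 4 →₀ ℕ) = d) := by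
    intro d _
    constructor
    · intro h
      have hdeg : d.degree = 0 := by
        have := congrArg (fun f : Fin 4 →₀ ℕ => f j) h
        simp only [chartExponent_univ_apply_self, Nat.sub_zero, Finsupp.coe_zero, Pi.zero_apply] at this
        exact this
      exact ((Finsupp.degree_eq_zero_iff d).mp hdeg).symm
    · rintro rfl
      ext i
      by_cases hij : i = j
      · rw [hij, chartExponent_univ_apply_self]; rfl
      · rw [chartExponent_apply_of_ne 0 Finset.univ hij]
  rw [Finset.sum_congr rfl fun d hd => if_congr (hiff d hd) rfl rfl, Finset.sum_ite_eq]
  split_ifs with h0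
  · rfl
  · exact (MvPolynomial.notMem_support_iff.mp h0).symm

/-- **Units stay units**: `(T₀u)(0) = u(0)` — the constant term of `chartTransform 0 univ j (shear j b u)` is
that of `u`. [folklore] -/
theorem eval_chartTransform_zero_shear [DecidableEq K] (j : Fin 4) (b : Fin 4 → K) (u : MvPolynomial (Fin 4) K) :
    eval 0 (chartTransform 0 Finset.univ j (shear j b u)) = eval 0 u := by
  have h1 : ∀ P : MvPolynomial (Fin 4) K, constantCoeff P = aeval (0 : Fin 4 → K) P := fun P => by
    rw [aeval_zero, Algebra.algebraMap_self_apply]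
  have hfun : (fun i => aeval (0 : Fin 4 → K)
      (if i = j then (X j : MvPolynomial (Fin 4) K) else X i + C (b i) * X j)) = (0 : Fin 4 → K) := by
    funext i
    by_cases hij : i = j
    · subst hij; rw [if_pos rfl, aeval_X, Pi.zero_apply]
    · rw [if_neg hij, map_add, map_mul, aeval_X, aeval_X, aeval_C, Pi.zero_apply, Pi.zero_apply, mul_zero,
        add_zero]
  rw [MvPolynomial.eval_zero, constantCoeff_chartTransform_zero, h1, h1]
  unfold shear
  rw [comp_aeval_apply, hfun]

/-- Degrees on the support of a power. [folklore] -/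
theorem forall_le_degree_pow {n : ℕ} {P : MvPolynomial (Fin 4) K} (hP : ∀ e ∈ P.support, n ≤ e.degree) :
    ∀ (d : ℕ), ∀ e ∈ (P ^ d).support, d * n ≤ e.degree := by
  intro d
  induction d with
  | zero => intro e _; rw [Nat.zero_mul]; exact Nat.zero_le _
  | succ d ih =>
    intro e he
    rw [pow_succ] at he
    have h := forall_le_degree_mul ih hP e he
    rw [Nat.succ_mul]
    exact h

/-- A polynomial vanishing at the origin has no constant monomial. [folklore] -/
theorem forall_one_le_degree_of_mem_originIdeal {h : MvPolynomial (Fin 4) K} (hh : h ∈ originIdeal K) :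
    ∀ e ∈ h.support, 1 ≤ e.degree := by
  intro e he
  by_contra hlt
  have h0 : e = 0 := (Finsupp.degree_eq_zero_iff e).mp (by omega)
  rw [h0, MvPolynomial.mem_support_iff] at he
  exact he ((NarrowApolarity.mem_originIdeal_iff h).mp hh)

/-- Degrees on the support of a difference. [folklore] -/
theorem forall_le_degree_sub {n : ℕ} {P Q : MvPolynomial (Fin 4) K} (hP : ∀ e ∈ P.support, n ≤ e.degree)
    (hQ : ∀ e ∈ Q.support, n ≤ e.degree) : ∀ e ∈ (P - Q).support, n ≤ e.degree := by
  intro e he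
  rcases Finset.mem_union.mp (MvPolynomial.support_sub (σ := Fin 4) P Q he) with h | h
  · exact hP e h
  · exact hQ e h

/-- `ord (S · x_a) ≥ n ⇒ ord S ≥ n − 1`. [folklore] -/
theorem forall_le_degree_of_mul_X {n : ℕ} {S : MvPolynomial (Fin 4) K} (a : Fin 4)
    (h : ∀ e ∈ (S * X a).support, n ≤ e.degree) : ∀ e ∈ S.support, n - 1 ≤ e.degree := by
  intro e he
  have hmem : e + Finsupp.single a 1 ∈ (S * X a).support := by
    rw [MvPolynomial.support_mul_X]
    exact Finset.mem_map_of_mem _ he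
  have h1 := h _ hmem
  rw [map_add, Finsupp.degree_single] at h1
  omega

/-! ## 2. Ledger persistence -/

section Step

variable [DecidableEq K]

/-- **LEDGER PERSISTENCE** (memo (K4); I-4-7 (LEDGER) through one `E_a`-keeping band step): for a state with
`x^r ∣ F`, `ord₀ F = o > q`, a kept boundary letter `a ≠ j` (`b_a = 0`) with `1 ≤ r_a < q`, a contact polynomial
`h ∈ 𝔪₀` and a ledger `u · G ∈ (x_a, h^d)` (`G = F/x^r`, `d = o − |r|`), the new residual satisfies
`T₀u · G′ ∈ (x_a, (T₁h)^d)` with `T_m = chartTransform m univ j ∘ shear j b` — NO shade hypothesis.  The deleted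
`q`-th powers lie in `(x_a)` because `q ∣ E_a ≥ r′_a = r_a ≥ 1` forces `E_a − r_a ≥ 1`. [OURS]
[cite: CossartJannsenSaito2020, Thm. 3.10(4), Thm. 9.3] -/
theorem ledger_persist {q : ℕ} (j : Fin 4) {b : Fin 4 → K} (hbj : b j = 0) {s : State K} {o : ℕ}
    (ho : ordZero s.F = o) (hr : ∀ d ∈ s.F.support, s.r ≤ d) (hqo : q < o) {a : Fin 4} (hja : j ≠ a)
    (hba : b a = 0) (hra : 1 ≤ s.r a) (hraq : s.r a < q) {h u : MvPolynomial (Fin 4) K}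
    (hh : h ∈ originIdeal K)
    (hG : u * s.F.divMonomial s.r ∈ Ideal.span {(X a : MvPolynomial (Fin 4) K), h ^ (o - s.r.degree)}) :
    chartTransform 0 Finset.univ j (shear j b u) *
        ((CentreBlowup.step q Finset.univ j b s).F.divMonomial (CentreBlowup.step q Finset.univ j b s).r) ∈
      Ideal.span {(X a : MvPolynomial (Fin 4) K),
        chartTransform 1 Finset.univ j (shear j b h) ^ (o - s.r.degree)} := by
  set d := o - s.r.degree with hd
  set G := s.F.divMonomial s.r with hGdef
  set r' := (CentreBlowup.step q Finset.univ j b s).r with hr'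
  set G' := (CentreBlowup.step q Finset.univ j b s).F.divMonomial r' with hG'def
  set U0 : MvPolynomial (Fin 4) K :=
    ∏ i ∈ Finset.univ.filter (fun i => b i ≠ 0), (X i + C (b i)) ^ (s.r i) with hU0
  have hsubX : ({(X a : MvPolynomial (Fin 4) K)} : Set (MvPolynomial (Fin 4) K)) ⊆
      {X a, chartTransform 1 Finset.univ j (shear j b h) ^ d} :=
    Set.singleton_subset_iff.mpr (Set.mem_insert _ _)
  -- (i) the deleted part lies in `(x_a)`
  have hr'a : r' a = s.r a := by
    rw [hr', step_r_univ q j hbj s ho hr, Finsupp.update_apply, if_neg hja.symm, Finsupp.filter_apply, if_pos hba]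
  have hdel : ∑ E ∈ (chartTransform q Finset.univ j (shear j b s.F)).support with IsPthPowerExponent q E,
      monomial (E - r') (coeff E (chartTransform q Finset.univ j (shear j b s.F))) ∈
        Ideal.span {(X a : MvPolynomial (Fin 4) K)} := by
    refine Ideal.sum_mem _ fun E hE => ?_
    obtain ⟨hEs, hP⟩ := Finset.mem_filter.mp hE
    have hle : r' ≤ E := step_r_le_of_mem_support_chartTransform_shear j hbj ho hr hqo.le hEs
    have hqa : q ∣ E a := (isPthPowerExponent_iff q E).mp hP a
    have hEa : q ≤ E a := Nat.le_of_dvd (by have := hle a; omega) hqa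
    have h1 : 1 ≤ (E - r') a := by rw [Finsupp.tsub_apply, hr'a]; omega
    refine Ideal.mem_span_singleton.mpr
      ⟨monomial (E - r' - Finsupp.single a 1) (coeff E (chartTransform q Finset.univ j (shear j b s.F))), ?_⟩
    rw [X, monomial_mul, one_mul, add_tsub_cancel_of_le]
    intro i
    by_cases hia : i = a
    · rw [hia, Finsupp.single_eq_same]; exact h1
    · rw [Finsupp.single_eq_of_ne hia]; exact Nat.zero_le _
  -- trivial case `d = 0`
  rcases Nat.eq_zero_or_pos d with hd0 | hd1
  · rw [hd0, pow_zero]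
    exact Ideal.mem_span_pair.mpr ⟨0, chartTransform 0 Finset.univ j (shear j b u) * G', by ring⟩
  -- degrees
  have hGdeg : ∀ e ∈ G.support, d ≤ e.degree := by
    intro e he
    rw [hGdef, MvPolynomial.mem_support_iff, coeff_divMonomial] at he
    have h1 := forall_le_degree_of_ordZero_eq ho (s.r + e) (MvPolynomial.mem_support_iff.mpr he)
    rw [map_add] at h1
    omega
  have huG : ∀ e ∈ (u * G).support, d ≤ e.degree := by
    have h1 := forall_le_degree_mul (fun _ _ => Nat.zero_le _) hGdeg (P := u)
    simpa only [Nat.zero_add] using h1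
  have hh1 : ∀ e ∈ h.support, 1 ≤ e.degree := forall_one_le_degree_of_mem_originIdeal hh
  have hhd : ∀ e ∈ (h ^ d).support, d ≤ e.degree := by
    have h1 := forall_le_degree_pow hh1 d
    simpa only [Nat.mul_one] using h1
  obtain ⟨S, T, hST⟩ := Ideal.mem_span_pair.mp hG
  have hSX : ∀ e ∈ (S * X a).support, d ≤ e.degree := by
    have h1 : S * X a = u * G - T * h ^ d := eq_sub_of_add_eq hST
    rw [h1]
    refine forall_le_degree_sub huG ?_
    have h2 := forall_le_degree_mul (fun _ _ => Nat.zero_le _) hhd (P := T)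
    simpa only [Nat.zero_add] using h2
  have hS : ∀ e ∈ S.support, d - 1 ≤ e.degree := forall_le_degree_of_mul_X a hSX
  -- (ii) the transform of the ledger identity: `T_d(uG) = x_a · T_{d−1}S + T₀T · (T₁h)^d`
  have hshear : shear j b (u * G) = shear j b S * X a + shear j b T * shear j b h ^ d := by
    rw [← hST]
    unfold shear
    rw [map_add, map_mul, map_mul, map_pow, aeval_X, if_neg hja.symm, hba, C_0, zero_mul, add_zero]
  have key : chartTransform d Finset.univ j (shear j b (u * G)) =
      X a * chartTransform (d - 1) Finset.univ j (shear j b S) +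
        chartTransform 0 Finset.univ j (shear j b T) * chartTransform 1 Finset.univ j (shear j b h) ^ d := by
    apply mul_left_cancel₀ (pow_ne_zero d (X_ne_zero j))
    rw [X_pow_mul_chartTransform_univ j (forall_le_degree_shear j b huG), hshear, map_add, map_mul, map_mul,
      map_pow, ← X_pow_mul_chartTransform_univ j (forall_le_degree_shear j b hS),
      ← X_pow_mul_chartTransform_univ j (forall_le_degree_shear j b hh1),
      ← X_pow_mul_chartTransform_univ j (fun _ _ => Nat.zero_le _) (m := 0) (P := shear j b T),
      coordBlowupSubst_X_of_mem_of_ne K _ j (Finset.mem_coe.mpr (Finset.mem_univ a)) hja.symm, pow_one, mul_pow,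
      pow_zero, one_mul,
      show (X j : MvPolynomial (Fin 4) K) ^ d = X j ^ (d - 1) * X j by
        rw [← pow_succ, Nat.sub_add_cancel hd1]]
    ring
  -- (iii) `T₀u · T_dG = T_d(uG)`
  have hprod : chartTransform 0 Finset.univ j (shear j b u) * chartTransform d Finset.univ j (shear j b G) =
      chartTransform d Finset.univ j (shear j b (u * G)) := by
    rw [shear_mul, ← chartTransform_mul j (fun _ _ => Nat.zero_le _) (forall_le_degree_shear j b hGdeg),
      Nat.zero_add]
  -- (iv) assemble with K5(a)
  have hG' : G' = U0 * chartTransform d Finset.univ j (shear j b G) -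
      ∑ E ∈ (chartTransform q Finset.univ j (shear j b s.F)).support with IsPthPowerExponent q E,
        monomial (E - r') (coeff E (chartTransform q Finset.univ j (shear j b s.F))) :=
    eq_sub_of_add_eq (divMonomial_step_F_add_deleted j hbj ho hr hqo.le)
  have hmem : X a * chartTransform (d - 1) Finset.univ j (shear j b S) +
      chartTransform 0 Finset.univ j (shear j b T) * chartTransform 1 Finset.univ j (shear j b h) ^ d ∈
      Ideal.span {(X a : MvPolynomial (Fin 4) K), chartTransform 1 Finset.univ j (shear j b h) ^ d} :=
    Ideal.mem_span_pair.mpr ⟨chartTransform (d - 1) Finset.univ j (shear j b S),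
      chartTransform 0 Finset.univ j (shear j b T), by ring⟩
  rw [hG', mul_sub]
  refine Ideal.sub_mem _ ?_ (Ideal.mul_mem_left _ _ (Ideal.span_mono hsubX hdel))
  rw [mul_left_comm, hprod, key]
  exact Ideal.mul_mem_left _ _ hmem

end Step

/-! ## 3. The transported contact polynomial still vanishes at the child -/

/-- The constant term of `chartTransform 1 univ j P`, for `P` without constant term, is the coefficient of `x_j`
in `P`. [folklore] -/
theorem constantCoeff_chartTransform_one (j : Fin 4) {P : MvPolynomial (Fin 4) K}
    (hP : ∀ e ∈ P.support, 1 ≤ e.degree) :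
    constantCoeff (chartTransform 1 Finset.univ j P) = coeff (Finsupp.single j 1) P := by
  classical
  unfold chartTransform
  rw [map_sum]
  simp_rw [constantCoeff_monomial]
  have hiff : ∀ d ∈ P.support, (chartExponent 1 Finset.univ j d = 0 ↔ Finsupp.single j 1 = d) := by
    intro d hd
    have h1 := hP d hd
    constructor
    · intro h
      have hdeg : d.degree = 1 := by
        have := congrArg (fun f : Fin 4 →₀ ℕ => f j) h
        simp only [chartExponent_univ_apply_self, Finsupp.coe_zero, Pi.zero_apply] at this
        omega
      symm
      ext i
      by_cases hij : i = j
      · rw [hij, Finsupp.single_eq_same]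
        have hoff : ∀ i, i ≠ j → d i = 0 := fun i hi => by
          have := congrArg (fun f : Fin 4 →₀ ℕ => f i) h
          simp only [chartExponent_apply_of_ne 1 Finset.univ hi, Finsupp.coe_zero, Pi.zero_apply] at this
          exact this
        rw [Finsupp.degree_eq_sum, ← Finset.sum_erase_add _ _ (Finset.mem_univ j),
          Finset.sum_eq_zero (fun i hi => hoff i (Finset.ne_of_mem_erase hi)), zero_add] at hdeg
        exact hdeg
      · rw [Finsupp.single_eq_of_ne hij]
        have := congrArg (fun f : Fin 4 →₀ ℕ => f i) h
        simp only [chartExponent_apply_of_ne 1 Finset.univ hij, Finsupp.coe_zero, Pi.zero_apply] at this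
        exact this
    · rintro rfl
      ext i
      by_cases hij : i = j
      · rw [hij, chartExponent_univ_apply_self, Finsupp.degree_single]; rfl
      · rw [chartExponent_apply_of_ne 1 Finset.univ hij, Finsupp.single_eq_of_ne hij]; rfl
  rw [Finset.sum_congr rfl fun d hd => if_congr (hiff d hd) rfl rfl, Finset.sum_ite_eq]
  split_ifs with h0
  · rfl
  · exact (MvPolynomial.notMem_support_iff.mp h0).symm

/-- In degree `n` the shear only sees the degree-`n` component: `coeff_e (shear P) = coeff_e (shear P_n)` for
`|e| = n`. [folklore] -/
theorem coeff_shear_eq_coeff_shear_homogeneousComponent (j : Fin 4) (t : Fin 4 → K) (P : MvPolynomial (Fin 4) K)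
    {e : Fin 4 →₀ ℕ} {n : ℕ} (he : e.degree = n) :
    coeff e (shear j t P) = coeff e (shear j t (homogeneousComponent n P)) := by
  classical
  conv_lhs => rw [← sum_homogeneousComponent P]
  unfold shear
  rw [map_sum, coeff_sum]
  rw [Finset.sum_eq_single n]
  · intro m _ hmn
    have hhom := isHomogeneous_shear j t (homogeneousComponent_isHomogeneous m P)
    unfold shear at hhom
    exact hhom.coeff_eq_zero (by rw [he]; exact Ne.symm hmn)
  · intro hn
    rw [Finset.mem_range, not_lt] at hn
    rw [homogeneousComponent_eq_zero n P (by omega), map_zero, coeff_zero]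

/-- The `x_j`-coefficient of a sheared linear form: `coeff_{e_j} (shear j b (Σ ℓ_i x_i)) = ℓ_j + ℓ·b` (`b_j = 0`).
[folklore] -/
theorem coeff_single_shear_linearForm (j : Fin 4) {b : Fin 4 → K} (hbj : b j = 0) (ℓ : Fin 4 → K) :
    coeff (Finsupp.single j 1) (shear j b (∑ i, C (ℓ i) * X i)) = ℓ j + dotProduct ℓ b := by
  unfold shear
  rw [map_sum, coeff_sum, dotProduct, ← Finset.sum_erase_add _ _ (Finset.mem_univ j),
    ← Finset.sum_erase_add _ (fun i => ℓ i * b i) (Finset.mem_univ j), hbj, mul_zero, add_zero, add_comm]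
  congr 1
  · rw [map_mul, aeval_C, algebraMap_eq, aeval_X, if_pos rfl, coeff_C_mul, coeff_X_same, mul_one]
  · refine Finset.sum_congr rfl fun i hi => ?_
    have hij : i ≠ j := Finset.ne_of_mem_erase hi
    rw [map_mul, aeval_C, algebraMap_eq, aeval_X, if_neg hij, coeff_C_mul, coeff_add, coeff_C_mul, coeff_X_same,
      coeff_X, if_neg (fun h => hij (Finsupp.single_left_injective one_ne_zero h)), zero_add, mul_one]

/-- **The transported contact polynomial vanishes at the child** (memo (K4), corollary): if `h ∈ 𝔪₀` has linear
part `c·ℓ + c′·x_a` (`a ≠ j`, `b_a = 0`; p-11's K9 output) and the chart point satisfies `ℓ_j + ℓ·b = 0`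
((VT)(i)), then `T₁h = chartTransform 1 univ j (shear j b h) ∈ 𝔪₀`. [OURS]
[cite: CossartJannsenSaito2020, Thm. 3.10(4), Thm. 9.3] -/
theorem ledger_persist_mem_originIdeal (j : Fin 4) {b : Fin 4 → K} (hbj : b j = 0) {a : Fin 4} (hja : j ≠ a)
    (hba : b a = 0) {h : MvPolynomial (Fin 4) K} (hh : h ∈ originIdeal K) {c c' : K} {ℓ : Fin 4 → K}
    (hlin : homogeneousComponent 1 h = C c * (∑ i, C (ℓ i) * X i) + C c' * X a)
    (hℓv : ℓ j + dotProduct ℓ b = 0) :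
    chartTransform 1 Finset.univ j (shear j b h) ∈ originIdeal K := by
  classical
  rw [NarrowApolarity.mem_originIdeal_iff,
    constantCoeff_chartTransform_one j (forall_le_degree_shear j b (forall_one_le_degree_of_mem_originIdeal hh)),
    coeff_shear_eq_coeff_shear_homogeneousComponent j b h (Finsupp.degree_single j 1), hlin]
  unfold shear
  rw [map_add, map_mul, map_mul, aeval_C, aeval_C, algebraMap_eq, coeff_add, coeff_C_mul,
    coeff_C_mul, aeval_X, if_neg hja.symm, hba, C_0, zero_mul, add_zero, coeff_X,
    if_neg (fun h => hja (Finsupp.single_left_injective one_ne_zero h).symm), mul_zero, add_zero]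
  have h1 := coeff_single_shear_linearForm j hbj ℓ
  unfold shear at h1
  rw [h1, hℓv, mul_zero]

end ResCone

end Summit.ResolutionOfSingularities.ResolutionOfSingularities.Theorems.PIDim4

end
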